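import Mathlib
import Summits.ValiantsHypothesis.ValiantsHypothesis.Theses.ElementaryWordLength
import Literature.Computability.AlgebraicComplexity.StandardFamilies
import Literature.Computability.AlgebraicComplexity.PermanentIrreducible
import Summits.ValiantsHypothesis.ValiantsHypothesis.Theorems.ElementaryWordLengthWordLengthQPStubTransfer
import Summits.ValiantsHypothesis.ValiantsHypothesis.Theorems.ElementaryWordLengthWordLengthQPStubIndgLetters
import Summits.ValiantsHypothesis.ValiantsHypothesis.Theorems.ElementaryWordLengthWordLengthQPStubLetterMachine
import Summits.ValiantsHypothesis.ValiantsHypothesis.Theorems.ElementaryWordLengthWordLengthQPStubContinuantTop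
import Summits.ValiantsHypothesis.ValiantsHypothesis.Theorems.ElementaryWordLengthWordLengthQPStubPerTop
import Summits.ValiantsHypothesis.ValiantsHypothesis.Theorems.ElementaryWordLengthWordLengthQPStubPerPatternIrred
import Summits.ValiantsHypothesis.ValiantsHypothesis.Theorems.ElementaryWordLengthWordLengthQPStubMainAW
import Summits.ValiantsHypothesis.ValiantsHypothesis.Theorems.ElementaryWordLengthWordLengthQPLadderPosOfX
import Summits.ValiantsHypothesis.ValiantsHypothesis.Theorems.ElementaryWordLengthWordLengthQPRungOne
import Summits.ValiantsHypothesis.ValiantsHypothesis.Theorems.ElementaryWordLengthWordLengthQPRungOneUniversal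
import Summits.ValiantsHypothesis.ValiantsHypothesis.Theorems.ElementaryWordLengthWordLengthQPRungOneSumW2
import Summits.ValiantsHypothesis.ValiantsHypothesis.Theorems.ElementaryWordLengthWordLengthQPRungOneOneWalk
import Summits.ValiantsHypothesis.ValiantsHypothesis.Theorems.ElementaryWordLengthWordLengthQPRungOneOneWalkCalculus
import Literature.Barriers.ValiantsHypothesis.PartialDerivativesDetPerm
import Literature.Barriers.ValiantsHypothesis.ShiftedPartialsMonotone
import Summits.ValiantsHypothesis.ValiantsHypothesis.Theorems.ElementaryWordLengthWordLengthQPStubTwoProducts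
import Summits.ValiantsHypothesis.ValiantsHypothesis.Theorems.ElementaryWordLengthWordLengthQPStubSpRankSumLe
import Summits.ValiantsHypothesis.ValiantsHypothesis.Theorems.ElementaryWordLengthWordLengthQPStubSpRankProdAffineLe
import Summits.ValiantsHypothesis.ValiantsHypothesis.Theorems.ElementaryWordLengthWordLengthQPStubSigmaPiSigmaLowDegreePerm
import Summits.ValiantsHypothesis.ValiantsHypothesis.Theorems.ElementaryWordLengthWordLengthQPRungOneNoSuperDegree
import Summits.ValiantsHypothesis.ValiantsHypothesis.Theorems.ElementaryWordLengthWordLengthQPStubRankOneCut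
import Summits.ValiantsHypothesis.ValiantsHypothesis.Theorems.ElementaryWordLengthWordLengthQPStubSAffineSingularOuter
import Summits.ValiantsHypothesis.ValiantsHypothesis.Theorems.ElementaryWordLengthWordLengthQPRungOneOneWalkGeneral
import Summits.ValiantsHypothesis.ValiantsHypothesis.Theorems.ElementaryWordLengthWordLengthQPIffEVH

/-!
# Skeleton of line `Sketch` (idea `eps-order-ladder`) for crux `WordLengthQP` (stmt-ValiantsHypothesis-6623) — v19 (seat c5: CALIBRATION LANDED p125416 `Theorems/ElementaryWordLengthWordLengthQPIffEVH.lean` — registered stubs `stub_vqpWordQp` (VQP ⊆ VQF in word form) and `stub_isVQPFamily_perPoly_of_hasWords` (qp words ⟹ PER ∈ VQP) proved there together with `wordLengthQP_iff_extendedValiantHypothesis : WordLengthQP ↔ ExtendedValiantHypothesis ℂ`, `wordLengthQP_iff_detqpThesis` and `ladderPos_iff_extendedValiantHypothesis`, imported and re-exported below as `sk_*`: the crux AND the one open stub are LITERALLY the Extended Valiant Hypothesis `¬ (VNP ℂ ⊆ VQP ℂ)` = the sibling crux `DetqpThesis`; v17 = seat c4, final: ALL eight side stubs of this seat LANDED and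 imported — wave 1 `stub_twoProducts` p123480, `stub_spRank_sum_le` p123427, `stub_spRank_prodAffine_le` p123556, `stub_sigmaPiSigma_lowDegree_perm` p123584; lead `stub_rungOne_E2_noSuperDegree` p123695; wave 2 `stub_rankOneCut` p124040, `stub_sAffine_singular_outer` p124072; lead `oneWalk_general` p124246 — re-exported below as `sk_*`; the ONE open stub is the content stub `stub_ladder_pos` = X)

Crux `X = WordLengthQP`: the affine elementary word length of `E₀₂(per_n)` in `E₃(ℂ[x])` is not
quasi-polynomially bounded.  Line (seats -0, c1): by Bringmann–Ikenmeyer–Zuiddam 2018 §3 the crux is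
EQUIVALENT (tree theorems `stub_transfer`, p108723, and `ladder_iff_wordLengthQP`, p110600) to the
ε-order ladder `EpsOrderLadder`: for every `c` some `per_n` has no border width-2 program over
`ℂ[ε][x̄]` with S-affine letters of ε-order `q` and length `L` both `≤ 2^((log₂ n + c)^c)`.

v8 → v9 (this seat, c2).  The ladder was split at the skeleton level into its length-free rung
`q = 0` and the rungs `q ≥ 1`; the rung `q = 0` is now a THEOREM OF THE TREE:
`rung0_nonuniversal` (for `n ≥ 10`, `per_n` is not the `(0,0)` entry of any product of width-2
matrices over `ℂ[x̄]` with S-affine entries — Allender–Wang 2016 / BIZ18 §5 non-universality for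
the permanent, proved via the six v8 stubs `stub_indgLetters` p114826, `stub_letterMachine` p117697
(+Aux p116228), `stub_continuantTop` p116873, `stub_perTop` p116608, `stub_perPatternIrred` p116765,
`stub_mainAW` p117954 (+Asg p117397, +Aux p117692), all landed, and the assembly file
`Theorems/ElementaryWordLengthWordLengthQPRung0Nonuniversal.lean` p118576: `rung0_lemmaB`,
`rung0_perRobust`, `rung0_nonuniversal`, `rung0_ladder_rung_zero`, `rung0_ladder_of_ladder_pos`,
`rung0_wordLengthQP_of_ladder_pos`, `rung0_ladderPos_iff_wordLengthQP`).

The ONE open stub is `stub_ladder_pos` — the rungs `q ≥ 1` (the Extended Valiant Hypothesis in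
ladder form above its settled exact rung; witnesses `n ≥ 10`, which X forces for `c ≥ 4` by BIZ18
Thm 3.1 universality of border width 2 for `per_n`, `n ≤ 9` — formalised: `ladderPos_of_wordLengthQP`,
p118026, so the open stub is CERTIFIED crux-equivalent by the tree theorem
`rung0_ladderPos_iff_wordLengthQP : stub_ladder_pos ↔ WordLengthQP`).  Composition:
`WordLengthQP_of := stub_transfer (sk_ladder_of_ladder_pos stub_ladder_pos)` — the skeleton carries kernel-checked
LOCAL copies `sk_*` of the landed assembly theorems (`rung0_*` of
`Theorems/ElementaryWordLengthWordLengthQPRung0Nonuniversal.lean`, p118576), built here directly on the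
six imported stub files, so that this workfile elaborates independently of that module; the tree
versions are the citable ones.  The typed first lemma of the
open rung `q = 1` (one-way cascade normal form, Leibniz at order `ε¹`) is the tree theorem
`rungOne_normal_form` (`Theorems/ElementaryWordLengthWordLengthQPRungOne.lean`, p119541).

Disproof used: none available (no `Disproof.lean` for this crux at 2026-08-16T19:45Z, `ledger crux ls`);
no stub-false / stub-misstated notes were posted on the item during seats -0, c1, c2, c3.

Seat c4 additions (all typed over existing declarations; none implies X):
* `stub_twoProducts` — the general skeleton is stronger than the unit-determinant one analysed in
  seat c3: `T₀₁(1)·∏diag(ℓ,1)·diag(ε,1)·∏diag(1,ℓ')·T₁₀(ε)` has `(0,0)` entry exactly `ε(P₁ + P₂)`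
  (length `d₁ + d₂ + 3`; one rank-1 skeleton letter, non-unit determinants).
* `stub_spRank_sum_le`, `stub_spRank_prodAffine_le`, `stub_sigmaPiSigma_lowDegree_perm` — the
  method of partial derivatives (Nisan–Wigderson 1996) over the tree's `shiftedPartialsRank K k 0`
  (`flatteningRank_perPoly`): sub-additivity, `rank ≤ binom(m,k)` for a product of `m` affine forms,
  and `T ≥ binom(n,k)` for `per_n = Σ_{i<T} c_i ∏_{j<m_i} ℓ_ij` with `m_i ≤ n`.
* `stub_rungOne_E2_noSuperDegree` — RUNG 1 WITHOUT TOP CANCELLATION: in the tangent normal form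
  `f = Σ_t (A_{<t} B_t A_{>t})₀₀` (`rungOne_normal_form`) with unit-determinant skeleton, if no path
  bundle `(A_{<t})₀ᵢ (B_t)ᵢⱼ (A_{>t})ⱼ₀` has degree `> n`, then `f = per_n` forces `4L ≥ binom(n,k)`:
  tops of E₂-walk entries are single products of linear forms (`stub_letterMachine`,
  `stub_continuantTop`), so the degree-`n` layer is a homogeneous `ΣΠ^{[n]}Σ` expression with `≤ 4L`
  terms. The whole difficulty of rung 1 is thereby located in the cancellation of super-degree tops
  (the inhomogeneous depth-3 phenomenon), for ONE shared E₂-walk.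
-/

-- `Summit.ValiantsHypothesis.ValiantsHypothesis.…` is the tree's mandated single-conjunct layout
-- (Sub = Summit), so the duplicated namespace component is intended.
set_option linter.dupNamespace false

noncomputable section

open MvPolynomial

namespace Summit.ValiantsHypothesis.ValiantsHypothesis.Cruxes.WordLengthQP.EpsOrderLadder

open Literature.Computability.AlgebraicComplexity

/-! ### Glue (proved): the unit-determinant case `sk_lemmaB` from the three letter stubs -/

/-- A polynomial whose top homogeneous part is a non-zero constant times a product of linear forms
has degree `≤ 1` or a top part that is a product of two positive-degree polynomials. [folklore] -/
theorem sk_notRobust_of_topIsProd {σ : Type} (f : MvPolynomial σ ℂ) (κ : ℂ) (hκ : κ ≠ 0)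
    (lins : List (MvPolynomial σ ℂ)) (hlins : ∀ l ∈ lins, l.IsHomogeneous 1 ∧ l ≠ 0)
    (htop : MvPolynomial.homogeneousComponent f.totalDegree f = MvPolynomial.C κ * lins.prod) :
    f.totalDegree ≤ 1 ∨ ∃ g h : MvPolynomial σ ℂ, 0 < g.totalDegree ∧ 0 < h.totalDegree ∧
      MvPolynomial.homogeneousComponent f.totalDegree f = g * h := by
  -- a product of non-zero linear forms is non-zero and homogeneous of degree the number of factors
  have hprod : ∀ ls : List (MvPolynomial σ ℂ), (∀ l ∈ ls, l.IsHomogeneous 1 ∧ l ≠ 0) →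
      ls.prod.IsHomogeneous ls.length ∧ ls.prod ≠ 0 := by
    intro ls
    induction ls with
    | nil => intro _; exact ⟨by simpa using isHomogeneous_one σ ℂ, one_ne_zero⟩
    | cons l ls ih =>
      intro h
      have hl := h l (by simp)
      have ht := ih (fun l' hl' => h l' (by simp [hl']))
      refine ⟨?_, ?_⟩
      · simpa [List.prod_cons, List.length_cons, add_comm] using hl.1.mul ht.1
      · simpa [List.prod_cons] using mul_ne_zero hl.2 ht.2
  by_cases hf : f = 0
  · left; simp [hf]
  have htopne : MvPolynomial.homogeneousComponent f.totalDegree f ≠ 0 := by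
    -- a monomial of top degree exists by definition of `totalDegree`
    obtain ⟨e, he, hedeg⟩ := Finset.exists_mem_eq_sup f.support
      (Finset.nonempty_of_ne_empty (by rwa [Ne, support_eq_empty])) (fun s => s.sum fun _ n => n)
    intro h0
    have := congrArg (coeff e) h0
    rw [coeff_homogeneousComponent, coeff_zero, if_pos] at this
    · exact (mem_support_iff.1 he) this
    · rw [totalDegree, hedeg, Finsupp.degree_apply]
      rfl
  obtain ⟨hhom, hne⟩ := hprod lins hlins
  have hdeg : f.totalDegree = lins.length := by
    have h1 : (MvPolynomial.homogeneousComponent f.totalDegree f).IsHomogeneous f.totalDegree :=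
      homogeneousComponent_isHomogeneous _ _
    have h2 : (MvPolynomial.homogeneousComponent f.totalDegree f).IsHomogeneous lins.length := by
      rw [htop]
      simpa using (isHomogeneous_C σ κ).mul hhom
    exact h1.inj_right h2 htopne
  rcases lins with _ | ⟨l₁, _ | ⟨l₂, rest⟩⟩
  · left; simp [hdeg]
  · left; simp [hdeg]
  · right
    have h₁ := hlins l₁ (by simp)
    obtain ⟨hhom', hne'⟩ := hprod (l₂ :: rest) (fun l hl => hlins l (by simp_all))
    refine ⟨MvPolynomial.C κ * l₁, (l₂ :: rest).prod, ?_, ?_, ?_⟩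
    · have : (MvPolynomial.C κ * l₁).IsHomogeneous 1 := by
        simpa using (isHomogeneous_C σ κ).mul h₁.1
      rw [this.totalDegree (mul_ne_zero (by simpa using hκ) h₁.2)]
      exact one_pos
    · rw [hhom'.totalDegree hne']
      simp
    · rw [htop]
      simp [List.prod_cons, mul_assoc]

/-- The image of a constant matrix under an assignment-free ring map bookkeeping: the letters
`w^ε · diag(d₁, d₂)` form a constant matrix. [folklore] -/
theorem sk_wPow_mul_diag_eq_map {σ : Type} (ε : ℕ) (d₁ d₂ : ℂ) :
    (!![0, 1; 1, 0] : Matrix (Fin 2) (Fin 2) (MvPolynomial σ ℂ)) ^ ε *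
        !![MvPolynomial.C d₁, 0; 0, MvPolynomial.C d₂] =
      (((!![0, 1; 1, 0] : Matrix (Fin 2) (Fin 2) ℂ) ^ ε * !![d₁, 0; 0, d₂]).map
        (MvPolynomial.C (σ := σ) (R := ℂ))) := by
  have h1 : ((!![0, 1; 1, 0] : Matrix (Fin 2) (Fin 2) ℂ).map (MvPolynomial.C (σ := σ) (R := ℂ)))
      = !![0, 1; 1, 0] := by
    ext i j; fin_cases i <;> fin_cases j <;> simp
  have h2 : ((!![d₁, 0; 0, d₂] : Matrix (Fin 2) (Fin 2) ℂ).map (MvPolynomial.C (σ := σ) (R := ℂ)))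
      = !![MvPolynomial.C d₁, 0; 0, MvPolynomial.C d₂] := by
    ext i j; fin_cases i <;> fin_cases j <;> simp
  rw [← (MvPolynomial.C (σ := σ) (R := ℂ)).mapMatrix_apply, map_mul, map_pow,
    RingHom.mapMatrix_apply, RingHom.mapMatrix_apply, h1, h2]

/-- **sk_lemmaB** (AW16 Cor. 37 / Remark 19, S-model; glued from `stub_indgLetters`,
`stub_letterMachine`, `stub_continuantTop`): a product of S-affine width-2 matrices with unit
determinants, between constant boundary matrices, computes a polynomial of degree `≤ 1` or one
whose top homogeneous part is a product of two positive-degree polynomials. -/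
theorem sk_lemmaB {σ : Type} [Fintype σ] [DecidableEq σ]
    (ms : List (Matrix (Fin 2) (Fin 2) (MvPolynomial σ ℂ))) (A B : Matrix (Fin 2) (Fin 2) ℂ)
    (hms : ∀ m ∈ ms, (∀ i j : Fin 2, (∃ b : ℂ, m i j = MvPolynomial.C b) ∨
        (∃ (a b : ℂ) (v : σ), m i j = MvPolynomial.C a * MvPolynomial.X v + MvPolynomial.C b)) ∧
      ∃ d : ℂ, d ≠ 0 ∧ m.det = MvPolynomial.C d)
    (f : MvPolynomial σ ℂ)
    (hf : f = ((A.map (MvPolynomial.C (σ := σ) (R := ℂ))) * ms.prod *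
      (B.map (MvPolynomial.C (σ := σ) (R := ℂ)))) 0 0) :
    f.totalDegree ≤ 1 ∨ ∃ g h : MvPolynomial σ ℂ, 0 < g.totalDegree ∧ 0 < h.totalDegree ∧
      MvPolynomial.homogeneousComponent f.totalDegree f = g * h := by
  classical
  -- (1) expand every matrix into letters
  have hws : ∃ ws : List (Matrix (Fin 2) (Fin 2) (MvPolynomial σ ℂ)),
      (∀ x ∈ ws, (∃ ℓ : MvPolynomial σ ℂ, ℓ.totalDegree ≤ 1 ∧ x = !![1, ℓ; 0, 1]) ∨
        x = !![0, 1; 1, 0] ∨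
        (∃ d₁ d₂ : ℂ, d₁ ≠ 0 ∧ d₂ ≠ 0 ∧
          x = !![MvPolynomial.C d₁, 0; 0, MvPolynomial.C d₂])) ∧
      ws.prod = ms.prod := by
    clear hf
    induction ms with
    | nil => exact ⟨[], by simp, by simp⟩
    | cons m ms ih =>
      obtain ⟨ws, hws, hprod⟩ := ih (fun m' hm' => hms m' (by simp [hm']))
      obtain ⟨ws₀, hws₀, hprod₀⟩ := stub_indgLetters m (hms m (by simp)).1 (hms m (by simp)).2
      refine ⟨ws₀ ++ ws, fun x hx => ?_, by simp [hprod, hprod₀]⟩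
      rcases List.mem_append.1 hx with h | h
      · exact hws₀ x h
      · exact hws x h
  obtain ⟨ws, hwsL, hwsprod⟩ := hws
  -- (2) the row vector `A 0` ; if it vanishes, `f = 0`
  by_cases hr : (fun k => A 0 k) = 0
  · left
    have hf0 : f = 0 := by
      rw [hf, Matrix.mul_apply]
      refine Finset.sum_eq_zero fun j _ => ?_
      rw [Matrix.mul_apply, Finset.sum_eq_zero, zero_mul]
      intro k _
      have : A 0 k = 0 := congrFun hr k
      simp [Matrix.map_apply, this]
    simp [hf0]
  -- (3) normal form of the row vector times the letter word
  obtain ⟨ls, ε, d₁, d₂, hd₁, hd₂, hdeg, hint, hvec⟩ :=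
    stub_letterMachine ws hwsL (fun k => A 0 k) hr
  -- the constant column produced by `w^ε · D · B`
  set W₀ : Matrix (Fin 2) (Fin 2) ℂ := (!![0, 1; 1, 0] : Matrix (Fin 2) (Fin 2) ℂ) ^ ε * !![d₁, 0; 0, d₂]
    with hW₀
  set c : Fin 2 → ℂ := fun k => ∑ j : Fin 2, W₀ k j * B j 0 with hc
  have hrow : ∀ j : Fin 2, ((A.map (MvPolynomial.C (σ := σ) (R := ℂ))) * ms.prod) 0 j =
      Matrix.vecMul (fun i => MvPolynomial.C (A 0 i)) ws.prod j := by
    intro j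
    rw [hwsprod]
    simp [Matrix.mul_apply, Matrix.vecMul, dotProduct, Matrix.map_apply]
  have hf' : f = ∑ k : Fin 2,
      (ls.map (fun L => (!![L, 1; 1, 0] : Matrix (Fin 2) (Fin 2) (MvPolynomial σ ℂ)))).prod 0 k *
        MvPolynomial.C (c k) := by
    rw [hf, Matrix.mul_apply]
    simp_rw [hrow, hvec]
    rw [Matrix.mul_assoc, sk_wPow_mul_diag_eq_map, ← hW₀]
    simp only [Matrix.vecMul, dotProduct, Fin.sum_univ_two, Matrix.cons_val_zero,
      Matrix.cons_val_one, one_mul, zero_mul, add_zero,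
      Matrix.mul_apply, Matrix.map_apply, hc, map_add, map_mul]
    ring
  rcases stub_continuantTop ls hdeg hint c f hf' with h0 | ⟨κ, lins, hκ, hlins, htop⟩
  · left; simp [h0]
  · exact sk_notRobust_of_topIsProd f κ hκ lins hlins htop

/-! ### Glue (proved): robustness of the permanent, rung 0, and the ladder -/

/-- **8-robustness of the permanent** (from `stub_perTop`, `stub_perPatternIrred`): for `n ≥ 10`,
after any assignment of constants to at most `8` cells, `per_n` has degree `≥ 2` and its top
homogeneous part is not a product of two positive-degree polynomials. -/
theorem sk_perRobust (n : ℕ) (hn : 10 ≤ n) (Z : Finset (Fin n × Fin n)) (a : Fin n × Fin n → ℂ)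
    (hZ : Z.card ≤ 8) (f : MvPolynomial (Fin n × Fin n) ℂ)
    (hf : f = MvPolynomial.aeval
      (fun v : Fin n × Fin n => if v ∈ Z then MvPolynomial.C (a v) else MvPolynomial.X v)
      (Literature.Computability.AlgebraicComplexity.perPoly (Fin n) ℂ)) :
    2 ≤ f.totalDegree ∧ ¬ ∃ g h : MvPolynomial (Fin n × Fin n) ℂ,
      0 < g.totalDegree ∧ 0 < h.totalDegree ∧
      MvPolynomial.homogeneousComponent f.totalDegree f = g * h := by
  obtain ⟨hρ, hirr⟩ := stub_perPatternIrred n Z (by omega)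
  obtain ⟨hdeg, htop⟩ := stub_perTop n Z a hρ f hf
  refine ⟨by omega, ?_⟩
  rintro ⟨g, h, hg, hh, hgh⟩
  rw [hdeg, htop] at hgh
  rcases hirr g h hgh.symm with h0 | h0 <;> omega

/-- **Rung 0, unconditional** (Allender–Wang-type non-universality for the permanent, S-model):
for `n ≥ 10`, `per_n` is not the `(0,0)` entry of any product of width-2 matrices over `ℂ[x̄]`
with S-affine entries. -/
theorem sk_nonuniversal (n : ℕ) (hn : 10 ≤ n)
    (ms : List (Matrix (Fin 2) (Fin 2) (MvPolynomial (Fin n × Fin n) ℂ)))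
    (hS : ∀ m ∈ ms, ∀ i j : Fin 2, (∃ b : ℂ, m i j = MvPolynomial.C b) ∨
      (∃ (a b : ℂ) (v : Fin n × Fin n),
        m i j = MvPolynomial.C a * MvPolynomial.X v + MvPolynomial.C b)) :
    ms.prod 0 0 ≠ Literature.Computability.AlgebraicComplexity.perPoly (Fin n) ℂ := by
  have h := stub_mainAW (σ := Fin n × Fin n)
    (Literature.Computability.AlgebraicComplexity.perPoly (Fin n) ℂ)
    (fun Z a hZ f hf => sk_perRobust n hn Z a hZ f hf)
    (fun ms A B hms f hf => sk_lemmaB ms A B hms f hf) ms hS 1 1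
  have h1 : ((1 : Matrix (Fin 2) (Fin 2) ℂ).map (MvPolynomial.C (σ := Fin n × Fin n) (R := ℂ))) = 1 :=
    Matrix.map_one _ (map_zero _) (map_one _)
  rwa [h1, one_mul, mul_one] at h

/-- **Rung 0 of the ladder, pointwise in `n`**: exact non-universality over `ℂ[x̄]` at `n` excludes
border width-2 S-affine programs of ε-order `0` (any length) at `n` — set `ε = 0`. [folklore] -/
theorem sk_pointwise (n : ℕ)
    (h : ∀ ms : List (Matrix (Fin 2) (Fin 2) (MvPolynomial (Fin n × Fin n) ℂ)),
      (∀ m ∈ ms, ∀ i j : Fin 2, (∃ b : ℂ, m i j = MvPolynomial.C b) ∨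
        (∃ (a b : ℂ) (v : Fin n × Fin n),
          m i j = MvPolynomial.C a * MvPolynomial.X v + MvPolynomial.C b)) →
      ms.prod 0 0 ≠ Literature.Computability.AlgebraicComplexity.perPoly (Fin n) ℂ) :
    ¬ (∃ ms : List (Matrix (Fin 2) (Fin 2) (MvPolynomial (Fin n × Fin n) (Polynomial ℂ))),
        (∀ m ∈ ms, ∀ i j : Fin 2, (∃ b : Polynomial ℂ, m i j = MvPolynomial.C b) ∨
          (∃ (a b : Polynomial ℂ) (v : Fin n × Fin n),
            m i j = MvPolynomial.C a * MvPolynomial.X v + MvPolynomial.C b)) ∧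
        ∃ G : MvPolynomial (Fin n × Fin n) (Polynomial ℂ),
          ms.prod 0 0 = MvPolynomial.map Polynomial.C
              (Literature.Computability.AlgebraicComplexity.perPoly (Fin n) ℂ) +
            MvPolynomial.C Polynomial.X * G) := by
  rintro ⟨ms, hS, G, hG⟩
  set φ : MvPolynomial (Fin n × Fin n) (Polynomial ℂ) →+* MvPolynomial (Fin n × Fin n) ℂ :=
    MvPolynomial.map (Polynomial.evalRingHom 0) with hφ
  refine h (ms.map (fun m => φ.mapMatrix m)) ?_ ?_
  · intro m hm i j
    obtain ⟨m₀, hm₀, rfl⟩ := List.mem_map.1 hm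
    rcases hS m₀ hm₀ i j with ⟨b, hb⟩ | ⟨a, b, v, hab⟩
    · exact Or.inl ⟨b.eval 0, by simp [hφ, RingHom.mapMatrix_apply, hb, map_C]⟩
    · exact Or.inr ⟨a.eval 0, b.eval 0, v, by
        simp [hφ, RingHom.mapMatrix_apply, hab, map_C, map_X]⟩
  · have hprod : (ms.map (fun m => φ.mapMatrix m)).prod = φ.mapMatrix ms.prod :=
      (map_list_prod φ.mapMatrix ms).symm
    rw [hprod, RingHom.mapMatrix_apply, Matrix.map_apply, hG, map_add, map_mul,
      MvPolynomial.map_C, MvPolynomial.map_map]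
    have hcomp : (Polynomial.evalRingHom (0 : ℂ)).comp Polynomial.C = RingHom.id ℂ := by
      ext x
      simp
    rw [hcomp, MvPolynomial.map_id]
    simp

/-- **Rung `q = 0` of the ε-order ladder, unconditionally** (discharges the hypothesis of the
landed reduction `ladder_rung0_of_nonuniversal`): for all `n ≥ 10` no border width-2 S-affine
program over `ℂ[ε][x̄]` — of ANY length — has `(0,0)` entry `per_n + ε · G`. -/
theorem sk_ladder_rung_zero :
    ∃ n₀ : ℕ, ∀ n ≥ n₀,
      ¬ (∃ ms : List (Matrix (Fin 2) (Fin 2) (MvPolynomial (Fin n × Fin n) (Polynomial ℂ))),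
          (∀ m ∈ ms, ∀ i j : Fin 2, (∃ b : Polynomial ℂ, m i j = MvPolynomial.C b) ∨
            (∃ (a b : Polynomial ℂ) (v : Fin n × Fin n),
              m i j = MvPolynomial.C a * MvPolynomial.X v + MvPolynomial.C b)) ∧
          ∃ G : MvPolynomial (Fin n × Fin n) (Polynomial ℂ),
            ms.prod 0 0 = MvPolynomial.map Polynomial.C
                (Literature.Computability.AlgebraicComplexity.perPoly (Fin n) ℂ) +
              MvPolynomial.C Polynomial.X * G) :=
  ⟨10, fun n hn => sk_pointwise n (fun ms hS => sk_nonuniversal n hn ms hS)⟩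

/-- **The full ε-order ladder from its rungs `q ≥ 1`.**  If for every `c` some `n ≥ 10` admits
no border width-2 S-affine program for `per_n` with `1 ≤ q ≤ 2^((log₂ n + c)^c)` and
`L ≤ 2^((log₂ n + c)^c)` (the open stub `stub_ladder_pos` of the skeleton), then the whole ladder
`EpsOrderLadder` holds — the rung `q = 0` being `sk_nonuniversal`. -/
theorem sk_ladder_of_ladder_pos
    (hpos : ∀ c : ℕ, ∃ n : ℕ, 10 ≤ n ∧ ∀ q L : ℕ, 1 ≤ q → q ≤ 2 ^ ((Nat.log 2 n + c) ^ c) →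
      L ≤ 2 ^ ((Nat.log 2 n + c) ^ c) →
      ¬ (∃ ms : List (Matrix (Fin 2) (Fin 2) (MvPolynomial (Fin n × Fin n) (Polynomial ℂ))),
          ms.length ≤ L ∧
          (∀ m ∈ ms, ∀ i j : Fin 2, (∃ b : Polynomial ℂ, m i j = MvPolynomial.C b) ∨
            (∃ (a b : Polynomial ℂ) (v : Fin n × Fin n),
              m i j = MvPolynomial.C a * MvPolynomial.X v + MvPolynomial.C b)) ∧
          ∃ G : MvPolynomial (Fin n × Fin n) (Polynomial ℂ),
            ms.prod 0 0 = MvPolynomial.C (Polynomial.X ^ q) *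
                MvPolynomial.map Polynomial.C
                  (Literature.Computability.AlgebraicComplexity.perPoly (Fin n) ℂ) +
              MvPolynomial.C (Polynomial.X ^ (q + 1)) * G)) :
    ∀ c : ℕ, ∃ n : ℕ, ∀ q L : ℕ, q ≤ 2 ^ ((Nat.log 2 n + c) ^ c) →
      L ≤ 2 ^ ((Nat.log 2 n + c) ^ c) →
      ¬ (∃ ms : List (Matrix (Fin 2) (Fin 2) (MvPolynomial (Fin n × Fin n) (Polynomial ℂ))),
          ms.length ≤ L ∧
          (∀ m ∈ ms, ∀ i j : Fin 2, (∃ b : Polynomial ℂ, m i j = MvPolynomial.C b) ∨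
            (∃ (a b : Polynomial ℂ) (v : Fin n × Fin n),
              m i j = MvPolynomial.C a * MvPolynomial.X v + MvPolynomial.C b)) ∧
          ∃ G : MvPolynomial (Fin n × Fin n) (Polynomial ℂ),
            ms.prod 0 0 = MvPolynomial.C (Polynomial.X ^ q) *
                MvPolynomial.map Polynomial.C
                  (Literature.Computability.AlgebraicComplexity.perPoly (Fin n) ℂ) +
              MvPolynomial.C (Polynomial.X ^ (q + 1)) * G) := by
  intro c
  obtain ⟨n, hn10, hposc⟩ := hpos c
  refine ⟨n, fun q L hq hL => ?_⟩
  rcases Nat.eq_zero_or_pos q with rfl | hq1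
  · rintro ⟨ms, -, hS, G, hG⟩
    refine sk_pointwise n (fun ms' hS' => sk_nonuniversal n hn10 ms' hS') ⟨ms, hS, G, ?_⟩
    simpa using hG
  · exact hposc q L hq1 hq hL

/-- **The open stub is crux-equivalent** (certificate for the planners): the rungs `q ≥ 1` of the
ε-order ladder with witnesses `n ≥ 10` (`stub_ladder_pos` of the skeleton) hold if and only if the
crux `WordLengthQP` does — `→` by `stub_transfer ∘ sk_ladder_of_ladder_pos` (rung 0 is a theorem), `←` by
`ladderPos_of_wordLengthQP` (de-bordering + universality of border width 2 for `per_n`, `n ≤ 9`). -/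
theorem sk_ladderPos_iff_wordLengthQP :
    (∀ c : ℕ, ∃ n : ℕ, 10 ≤ n ∧ ∀ q L : ℕ, 1 ≤ q → q ≤ 2 ^ ((Nat.log 2 n + c) ^ c) →
      L ≤ 2 ^ ((Nat.log 2 n + c) ^ c) →
      ¬ (∃ ms : List (Matrix (Fin 2) (Fin 2) (MvPolynomial (Fin n × Fin n) (Polynomial ℂ))),
          ms.length ≤ L ∧
          (∀ m ∈ ms, ∀ i j : Fin 2, (∃ b : Polynomial ℂ, m i j = MvPolynomial.C b) ∨
            (∃ (a b : Polynomial ℂ) (v : Fin n × Fin n),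
              m i j = MvPolynomial.C a * MvPolynomial.X v + MvPolynomial.C b)) ∧
          ∃ G : MvPolynomial (Fin n × Fin n) (Polynomial ℂ),
            ms.prod 0 0 = MvPolynomial.C (Polynomial.X ^ q) *
                MvPolynomial.map Polynomial.C
                  (Literature.Computability.AlgebraicComplexity.perPoly (Fin n) ℂ) +
              MvPolynomial.C (Polynomial.X ^ (q + 1)) * G)) ↔
    Summit.ValiantsHypothesis.ValiantsHypothesis.Theses.ElementaryWordLength.WordLengthQP :=
  by
    refine ⟨fun hpos => ?_, ladderPos_of_wordLengthQP⟩
    unfold Summit.ValiantsHypothesis.ValiantsHypothesis.Theses.ElementaryWordLength.WordLengthQP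
    exact stub_transfer (sk_ladder_of_ladder_pos hpos)

/-! ### Rung `q = 1` (seat c3): universal length-free (LANDED, imported:
`rungOne_universal`, `rungOne_perPoly`, `rungOne_not_lengthFree`, p121154); its `Σ W2` relaxation
and why that relaxation is `ΣΠΣ`-hard (LANDED, imported: `rungOne_sumW2_of_orderOne`,
`rungOne_of_sumW2Hard`, `sumW2_of_sigmaPiSigma`, p121398) -/

/-- **Certificate (imported, p121154): the length-free strengthening of rung `q = 1` is false.**
Re-exported under a skeleton-local name so the audit sees it next to the open stub. -/
theorem sk_rungOne_not_lengthFree :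
    ¬ ∃ n₀ : ℕ, ∀ n ≥ n₀,
      ¬ (∃ ms : List (Matrix (Fin 2) (Fin 2) (MvPolynomial (Fin n × Fin n) (Polynomial ℂ))),
          (∀ m ∈ ms, ∀ i j : Fin 2, (∃ b : Polynomial ℂ, m i j = MvPolynomial.C b) ∨
            (∃ (a b : Polynomial ℂ) (v : Fin n × Fin n),
              m i j = MvPolynomial.C a * MvPolynomial.X v + MvPolynomial.C b)) ∧
          ∃ G : MvPolynomial (Fin n × Fin n) (Polynomial ℂ),
            ms.prod 0 0 = MvPolynomial.C (Polynomial.X ^ 1) *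
                MvPolynomial.map Polynomial.C
                  (Literature.Computability.AlgebraicComplexity.perPoly (Fin n) ℂ) +
              MvPolynomial.C (Polynomial.X ^ (1 + 1)) * G) :=
  rungOne_not_lengthFree

/-- **Certificate (imported, p121398): rung `q = 1` from `Σ W2`-hardness of the permanent** —
the `Σ W2` relaxation implies the `q = 1` slice of the open stub (skeleton-local re-export). -/
theorem sk_rungOne_of_sumW2Hard
    (h : ∀ c : ℕ, ∃ n : ℕ, 10 ≤ n ∧ ∀ L : ℕ, L ≤ 2 ^ ((Nat.log 2 n + c) ^ c) →
      ¬ ∃ ws : List (List (Matrix (Fin 2) (Fin 2) (MvPolynomial (Fin n × Fin n) ℂ))),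
          ws.length ≤ L ∧
          (∀ w ∈ ws, w.length ≤ L ∧ ∀ m ∈ w, ∀ i j : Fin 2, (∃ b : ℂ, m i j = MvPolynomial.C b) ∨
            (∃ (a b : ℂ) (v : Fin n × Fin n),
              m i j = MvPolynomial.C a * MvPolynomial.X v + MvPolynomial.C b)) ∧
          (ws.map (fun w => w.prod 0 0)).sum =
            Literature.Computability.AlgebraicComplexity.perPoly (Fin n) ℂ) :
    ∀ c : ℕ, ∃ n : ℕ, 10 ≤ n ∧ ∀ L : ℕ, L ≤ 2 ^ ((Nat.log 2 n + c) ^ c) →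
      ¬ (∃ ms : List (Matrix (Fin 2) (Fin 2) (MvPolynomial (Fin n × Fin n) (Polynomial ℂ))),
          ms.length ≤ L ∧
          (∀ m ∈ ms, ∀ i j : Fin 2, (∃ b : Polynomial ℂ, m i j = MvPolynomial.C b) ∨
            (∃ (a b : Polynomial ℂ) (v : Fin n × Fin n),
              m i j = MvPolynomial.C a * MvPolynomial.X v + MvPolynomial.C b)) ∧
          ∃ G : MvPolynomial (Fin n × Fin n) (Polynomial ℂ),
            ms.prod 0 0 = MvPolynomial.C (Polynomial.X ^ 1) *
                MvPolynomial.map Polynomial.C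
                  (Literature.Computability.AlgebraicComplexity.perPoly (Fin n) ℂ) +
              MvPolynomial.C (Polynomial.X ^ (1 + 1)) * G) :=
  rungOne_of_sumW2Hard h

/-! ### Rung `q = 1` (seat c3): the one-walk quadratic normal form `rungOne_oneWalk_normal_form` /
`oneWalk_sandwich` (LANDED p121679, imported) and its rewriting calculus (`oneWalk_Q_add/_smul/_start`,
`oneWalk_Q_absorb`, LANDED p122008, imported) -/

/-- **Neighbour absorption** (registered stub of seat c3, LANDED p122008; skeleton-local re-export):
moving an insertion of the one-walk quadratic form `Q(N)(p, q) = p² N₀₁ − q² N₁₀ + p q (N₁₁ − N₀₀)`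
across a letter `A` conjugates it, `Q(N)(r · A) = Q(A · N · adj A)(r)`. -/
theorem sk_oneWalk_Q_absorb {R : Type} [CommRing R] (A N : Matrix (Fin 2) (Fin 2) R) (p q : R) :
    (p * A 0 0 + q * A 1 0) ^ 2 * N 0 1 - (p * A 0 1 + q * A 1 1) ^ 2 * N 1 0 +
        (p * A 0 0 + q * A 1 0) * (p * A 0 1 + q * A 1 1) * (N 1 1 - N 0 0) =
      p ^ 2 * (A * N * A.adjugate) 0 1 - q ^ 2 * (A * N * A.adjugate) 1 0 +
        p * q * ((A * N * A.adjugate) 1 1 - (A * N * A.adjugate) 0 0) :=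
  oneWalk_Q_absorb A N p q

/-! ### Seat c4 (registered side stubs, ALL LANDED and imported): the GENERAL rung-1 skeleton, and
rung 1 without top cancellation via the method of partial derivatives -/

/-- **Two products for free** (registered stub of seat c4, LANDED p123480; skeleton-local
re-export): `T₀₁(1) · ∏ diag(ℓ,1) · diag(ε,1) · ∏ diag(1,ℓ') · T₁₀(ε)` has `(0,0)` entry exactly
`ε · (P₁ + P₂)` — the general rung-1 skeleton (one rank-1 letter, non-unit determinants) adds two
arbitrary products of S-affine letters at length `d₁ + d₂ + 3`. -/
theorem sk_twoProducts {σ : Type} (ls₁ ls₂ : List (MvPolynomial σ ℂ))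
    (h : ∀ ℓ ∈ ls₁ ++ ls₂, ∃ (a b : ℂ) (v : σ),
      ℓ = MvPolynomial.C a * MvPolynomial.X v + MvPolynomial.C b) :
    ∃ ms : List (Matrix (Fin 2) (Fin 2) (MvPolynomial σ (Polynomial ℂ))),
      ms.length = ls₁.length + ls₂.length + 3 ∧
      (∀ m ∈ ms, ∀ i j : Fin 2, (∃ b : Polynomial ℂ, m i j = MvPolynomial.C b) ∨
        (∃ (a b : Polynomial ℂ) (v : σ),
          m i j = MvPolynomial.C a * MvPolynomial.X v + MvPolynomial.C b)) ∧
      ms.prod 0 0 = MvPolynomial.C Polynomial.X *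
        MvPolynomial.map Polynomial.C (ls₁.prod + ls₂.prod) :=
  stub_twoProducts ls₁ ls₂ h

/-- **Sub-additivity of the method of partial derivatives** (registered stub of seat c4, LANDED
p123427; skeleton-local re-export). -/
theorem sk_spRank_sum_le {K : Type} [Field K] {σ : Type} [Fintype σ] [DecidableEq σ]
    {ι : Type} (s : Finset ι) (c : ι → K) (f : ι → MvPolynomial σ K) (k : ℕ) :
    Literature.Barriers.ValiantsHypothesis.shiftedPartialsRank K k 0
        (∑ i ∈ s, MvPolynomial.C (c i) * f i) ≤
      ∑ i ∈ s, Literature.Barriers.ValiantsHypothesis.shiftedPartialsRank K k 0 (f i) :=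
  stub_spRank_sum_le s c f k

/-- **Partials of a product of affine forms** (registered stub of seat c4, LANDED p123556;
skeleton-local re-export): flattening rank `≤ binom(m,k)`. -/
theorem sk_spRank_prodAffine_le {K : Type} [Field K] {σ : Type} [Fintype σ] [DecidableEq σ]
    (ls : List (MvPolynomial σ K)) (hls : ∀ ℓ ∈ ls, ℓ.totalDegree ≤ 1) (k : ℕ) :
    Literature.Barriers.ValiantsHypothesis.shiftedPartialsRank K k 0 ls.prod ≤ ls.length.choose k :=
  stub_spRank_prodAffine_le ls hls k

/-- **Nisan–Wigderson for the permanent at product fan-in `≤ n`** (registered stub of seat c4,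
LANDED p123584; skeleton-local re-export): `per_n = Σ_{i∈s} c_i ∏ (Ls i)` with affine factors and
`|Ls i| ≤ n` forces `#s ≥ binom(n,k)`. -/
theorem sk_sigmaPiSigma_lowDegree_perm (n : ℕ) {ι : Type} (s : Finset ι) (c : ι → ℂ)
    (Ls : ι → List (MvPolynomial (Fin n × Fin n) ℂ))
    (hdeg : ∀ i ∈ s, ∀ ℓ ∈ Ls i, ℓ.totalDegree ≤ 1) (hlen : ∀ i ∈ s, (Ls i).length ≤ n)
    (hper : Literature.Computability.AlgebraicComplexity.perPoly (Fin n) ℂ =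
      ∑ i ∈ s, MvPolynomial.C (c i) * (Ls i).prod)
    (k : ℕ) (hk : k ≤ n) :
    n.choose k ≤ s.card :=
  stub_sigmaPiSigma_lowDegree_perm n s c Ls hdeg hlen hper k hk

/-- **RUNG 1 WITHOUT TOP CANCELLATION IS EXPONENTIAL** (registered stub of seat c4, the lead's,
LANDED p123695; skeleton-local re-export).  In the tangent normal form
`f = Σ_t (A_{<t} B_t A_{>t})₀₀` with a unit-determinant (E₂) S-affine skeleton, if no path bundle
`(A_{<t})₀ᵢ (B_t)ᵢⱼ (A_{>t})ⱼ₀` has degree `> n`, then `f = per_n` forces `4L ≥ binom(n,k)` for all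
`k ≤ n` (`L ≥ 2ⁿ/(4(n+1))` at `k = ⌊n/2⌋`).  The skeleton condition `(∏A)₀₀ = 0` is not used:
the bound charges exactly the absence of super-degree cancellation along the shared E₂-walk. -/
theorem sk_rungOne_E2_noSuperDegree (n : ℕ)
    (As Bs : List (Matrix (Fin 2) (Fin 2) (MvPolynomial (Fin n × Fin n) ℂ)))
    (hlen : Bs.length = As.length)
    (hA : ∀ A ∈ As, (∀ i j : Fin 2, (∃ b : ℂ, A i j = MvPolynomial.C b) ∨
        (∃ (a b : ℂ) (v : Fin n × Fin n),
          A i j = MvPolynomial.C a * MvPolynomial.X v + MvPolynomial.C b)) ∧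
      ∃ d : ℂ, d ≠ 0 ∧ A.det = MvPolynomial.C d)
    (hB : ∀ B ∈ Bs, ∀ i j : Fin 2, (∃ b : ℂ, B i j = MvPolynomial.C b) ∨
        (∃ (a b : ℂ) (v : Fin n × Fin n),
          B i j = MvPolynomial.C a * MvPolynomial.X v + MvPolynomial.C b))
    (hdeg : ∀ t < As.length, ∀ i j : Fin 2,
      ((As.take t).prod 0 i * Bs.getD t 0 i j * (As.drop (t + 1)).prod j 0).totalDegree ≤ n)
    (hf : Literature.Computability.AlgebraicComplexity.perPoly (Fin n) ℂ =
      (∑ t ∈ Finset.range As.length,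
        (As.take t).prod * Bs.getD t 0 * (As.drop (t + 1)).prod) 0 0)
    (k : ℕ) (hk : k ≤ n) :
    n.choose k ≤ 4 * As.length :=
  stub_rungOne_E2_noSuperDegree n As Bs hlen hA hB hdeg hf k hk

/-! ### Seat c4, wave 2 (registered side stubs, LANDED and imported): singular letters CUT the
tangent form (one-window decomposition), and the GENERAL one-walk normal form -/

/-- **One-window cut** (registered stub of seat c4, LANDED p124040; skeleton-local re-export): at
an outer-product letter `A_s = α βᵀ`, `(∏A)₀₀ = 0` kills all tangent terms on one side of `s`. -/
theorem sk_rankOneCut {R : Type} [CommRing R] [IsDomain R]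
    (As Bs : List (Matrix (Fin 2) (Fin 2) R)) (s : ℕ) (hs : s < As.length)
    (α β : Fin 2 → R) (hAs : As[s] = Matrix.vecMulVec α β)
    (h0 : As.prod 0 0 = 0) :
    (∀ t, s < t → t < As.length →
        ((As.take t).prod * Bs.getD t 0 * (As.drop (t + 1)).prod) 0 0 = 0) ∨
    (∀ t, t < s →
        ((As.take t).prod * Bs.getD t 0 * (As.drop (t + 1)).prod) 0 0 = 0) :=
  stub_rankOneCut As Bs s hs α β hAs h0

/-- **Singular S-affine letters are outer products with one constant factor** (registered stub of
seat c4, LANDED p124072; skeleton-local re-export). -/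
theorem sk_sAffine_singular_outer {σ : Type} [Fintype σ] [DecidableEq σ]
    (m : Matrix (Fin 2) (Fin 2) (MvPolynomial σ ℂ))
    (hS : ∀ i j : Fin 2, (∃ b : ℂ, m i j = MvPolynomial.C b) ∨
      (∃ (a b : ℂ) (v : σ), m i j = MvPolynomial.C a * MvPolynomial.X v + MvPolynomial.C b))
    (hdet : m.det = 0) :
    ∃ α β : Fin 2 → MvPolynomial σ ℂ, m = Matrix.vecMulVec α β ∧
      ((∀ i, ∃ c : ℂ, α i = MvPolynomial.C c) ∨ (∀ j, ∃ c : ℂ, β j = MvPolynomial.C c)) ∧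
      (∀ i, (α i).totalDegree ≤ 1) ∧ (∀ j, (β j).totalDegree ≤ 1) :=
  stub_sAffine_singular_outer m hS hdet

open Matrix in
/-- **General one-walk normal form of rung 1** (registered stub of seat c4, the lead's, LANDED
p124246; skeleton-local re-export): for ARBITRARY skeleton letters, with `r_t = βᵀA_{<t}`,
`Q_t(r) = r (B_t J A_tᵀ) rᵀ`, `D_{>t} = ∏_{s>t} det A_s`, `u = (∏A)ᵀβ`, `w = J u`:
`βᵀ(∏A)α = 0 ⟹ w_i · Σ_t βᵀA_{<t}B_tA_{>t}α = α_i · Σ_t D_{>t} Q_t(r_t)`.  Terms left of a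
singular letter drop out of the right-hand side; between non-unit letters the stretches are
weighted by the determinants still to come. -/
theorem sk_oneWalk_general {R : Type} [CommRing R] (As Bs : List (Matrix (Fin 2) (Fin 2) R))
    (β α : Fin 2 → R) (h0 : β ⬝ᵥ (As.prod *ᵥ α) = 0) (i : Fin 2) :
    (!![0, -1; 1, 0] *ᵥ (β ᵥ* As.prod)) i *
        ∑ t ∈ Finset.range As.length,
          β ⬝ᵥ (((As.take t).prod * Bs.getD t 0 * (As.drop (t + 1)).prod) *ᵥ α) =
      α i * ∑ t ∈ Finset.range As.length,
        ((As.drop (t + 1)).map Matrix.det).prod *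
          ((β ᵥ* (As.take t).prod) ⬝ᵥ
            ((Bs.getD t 0 * !![0, -1; 1, 0] * (As.getD t 0)ᵀ) *ᵥ (β ᵥ* (As.take t).prod))) :=
  oneWalk_general As Bs β α h0 i

/-! ### Seat c5: CALIBRATION (registered stubs `stub_vqpWordQp`, `stub_isVQPFamily_perPoly_of_hasWords`
LANDED p125416 and imported; re-exported here) — the crux is the Extended Valiant Hypothesis -/

/-- **`VQP ⊆ VQF` in word form** (registered stub of seat c5, LANDED p125416; skeleton-local
re-export): every `VQP` family over `ℂ` has quasi-polynomial affine elementary words. -/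
theorem sk_vqpWordQp {σ : ℕ → Type} [∀ n, Fintype (σ n)] (f : ∀ n, MvPolynomial (σ n) ℂ)
    (hf : IsVQPFamily f) :
    ∃ c : ℕ, ∀ n : ℕ, ∃ w : List (Fin 3 × Fin 3 × ℂ × Option (σ n)),
      w.length ≤ 2 ^ ((Nat.log 2 n + c) ^ c) ∧ (∀ l ∈ w, l.1 ≠ l.2.1) ∧
      (w.map (fun l => Matrix.transvection l.1 l.2.1
        (MvPolynomial.C l.2.2.1 * l.2.2.2.elim 1 MvPolynomial.X))).prod =
        Matrix.transvection (0 : Fin 3) 2 (f n) :=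
  stub_vqpWordQp f hf

/-- **The crux is `PER ∉ VQP` over `ℂ`** (LANDED p125416; skeleton-local re-export).
[cite: BurgisserClausenShokrollahi1997, (21.41) p. 598] -/
theorem sk_wordLengthQP_iff_not_isVQPFamily :
    Summit.ValiantsHypothesis.ValiantsHypothesis.Theses.ElementaryWordLength.WordLengthQP ↔
      ¬ IsVQPFamily (fun n => perPoly (Fin n) ℂ) :=
  wordLengthQP_iff_not_isVQPFamily_perPoly

/-- **The crux is the Extended Valiant Hypothesis over `ℂ`** (`¬ (VNP ℂ ⊆ VQP ℂ)`, BCS97 (21.32);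
open, Problem 21.5; LANDED p125416, skeleton-local re-export). [cite: BurgisserClausenShokrollahi1997, (21.32) p. 591] -/
theorem sk_wordLengthQP_iff_EVH :
    Summit.ValiantsHypothesis.ValiantsHypothesis.Theses.ElementaryWordLength.WordLengthQP ↔
      ExtendedValiantHypothesis ℂ :=
  wordLengthQP_iff_extendedValiantHypothesis

/-- **The rank-0 cruxes of routes `ElementaryWordLength` and `DetQP` are one proposition**
(stmt-ValiantsHypothesis-6623 ↔ stmt-ValiantsHypothesis-0315; LANDED p125416, re-export).
[cite: BurgisserClausenShokrollahi1997, (21.40)–(21.41) p. 598] -/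
theorem sk_wordLengthQP_iff_detqpThesis :
    Summit.ValiantsHypothesis.ValiantsHypothesis.Theses.ElementaryWordLength.WordLengthQP ↔
      Summit.ValiantsHypothesis.ValiantsHypothesis.Theses.DetQP.DetqpThesis :=
  wordLengthQP_iff_detqpThesis

/-! ### The one open stub and the composition -/

/-- **stub_ladder_pos** (OPEN — the ε-order ladder above its exact rung; crux-equivalent at
quasi-polynomial scale): for every `c` there is `n ≥ 10` such that no product of at most
`L ≤ 2^((log₂ n + c)^c)` width-2 matrices with S-affine entries over `ℂ[ε][x]` has `(0,0)` entry
`ε^q · per_n + ε^(q+1) · G` with `1 ≤ q ≤ 2^((log₂ n + c)^c)`. -/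
theorem stub_ladder_pos :
    ∀ c : ℕ, ∃ n : ℕ, 10 ≤ n ∧ ∀ q L : ℕ, 1 ≤ q → q ≤ 2 ^ ((Nat.log 2 n + c) ^ c) →
      L ≤ 2 ^ ((Nat.log 2 n + c) ^ c) →
      ¬ (∃ ms : List (Matrix (Fin 2) (Fin 2) (MvPolynomial (Fin n × Fin n) (Polynomial ℂ))),
          ms.length ≤ L ∧
          (∀ m ∈ ms, ∀ i j : Fin 2, (∃ b : Polynomial ℂ, m i j = MvPolynomial.C b) ∨
            (∃ (a b : Polynomial ℂ) (v : Fin n × Fin n),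
              m i j = MvPolynomial.C a * MvPolynomial.X v + MvPolynomial.C b)) ∧
          ∃ G : MvPolynomial (Fin n × Fin n) (Polynomial ℂ),
            ms.prod 0 0 = MvPolynomial.C (Polynomial.X ^ q) *
                MvPolynomial.map Polynomial.C
                  (Literature.Computability.AlgebraicComplexity.perPoly (Fin n) ℂ) +
              MvPolynomial.C (Polynomial.X ^ (q + 1)) * G) := by
  sorry

/-- **The one open stub is the Extended Valiant Hypothesis** (seat c5): `stub_ladder_pos` —
the rungs `q ≥ 1` of the ε-order ladder — holds iff `VNP ℂ ⊄ VQP ℂ`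
(LANDED p125416 as `ladderPos_iff_extendedValiantHypothesis`; re-export).  Any completion of this skeleton
is a proof of the Extended Valiant Hypothesis; nothing in the line's Leans-on (BIZ18, AW16, Brent,
Nisan–Wigderson partials) speaks to it. [cite: BurgisserClausenShokrollahi1997, (21.32) p. 591 and Problem 21.5 p. 605] -/
theorem sk_ladderPos_iff_EVH :
    (∀ c : ℕ, ∃ n : ℕ, 10 ≤ n ∧ ∀ q L : ℕ, 1 ≤ q → q ≤ 2 ^ ((Nat.log 2 n + c) ^ c) →
      L ≤ 2 ^ ((Nat.log 2 n + c) ^ c) →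
      ¬ (∃ ms : List (Matrix (Fin 2) (Fin 2) (MvPolynomial (Fin n × Fin n) (Polynomial ℂ))),
          ms.length ≤ L ∧
          (∀ m ∈ ms, ∀ i j : Fin 2, (∃ b : Polynomial ℂ, m i j = MvPolynomial.C b) ∨
            (∃ (a b : Polynomial ℂ) (v : Fin n × Fin n),
              m i j = MvPolynomial.C a * MvPolynomial.X v + MvPolynomial.C b)) ∧
          ∃ G : MvPolynomial (Fin n × Fin n) (Polynomial ℂ),
            ms.prod 0 0 = MvPolynomial.C (Polynomial.X ^ q) *
                MvPolynomial.map Polynomial.C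
                  (Literature.Computability.AlgebraicComplexity.perPoly (Fin n) ℂ) +
              MvPolynomial.C (Polynomial.X ^ (q + 1)) * G)) ↔
    ExtendedValiantHypothesis ℂ :=
  ladderPos_iff_extendedValiantHypothesis

/-- **Composition.** The crux `WordLengthQP`, BY NAME: the landed transfer `stub_transfer` applied to
the full ladder `sk_ladder_of_ladder_pos stub_ladder_pos` (= tree `rung0_ladder_of_ladder_pos`:
rung 0 theorem + the one open stub, rungs `q ≥ 1`). -/
theorem WordLengthQP_of :
    Summit.ValiantsHypothesis.ValiantsHypothesis.Theses.ElementaryWordLength.WordLengthQP := by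
  unfold Summit.ValiantsHypothesis.ValiantsHypothesis.Theses.ElementaryWordLength.WordLengthQP
  exact stub_transfer (sk_ladder_of_ladder_pos stub_ladder_pos)

end Summit.ValiantsHypothesis.ValiantsHypothesis.Cruxes.WordLengthQP.EpsOrderLadder
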